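import Mathlib.NumberTheory.Padics.Hensel
import Mathlib.NumberTheory.Padics.RingHoms
import Mathlib.NumberTheory.NumberField.Basic
import Mathlib.FieldTheory.IsAlgClosed.Classification
import Mathlib.FieldTheory.IsAlgClosed.AlgebraicClosure
import Mathlib.FieldTheory.PrimitiveElement
import Mathlib.Analysis.Complex.Cardinality
import Mathlib.Analysis.Complex.Polynomial.Basic
import Mathlib.Topology.Algebra.Module.Cardinality
import Mathlib.RingTheory.Polynomial.RationalRoot
import Mathlib.SetTheory.Cardinal.Continuum
import Literature.NumberTheory.Sieve.PrimeDivisorsOfPolynomials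
import HarnessLib

/-!
# Compatible `ℓ`-adic and complex embeddings of a number field

Everything in this file is PROVED (no `sorry`, no named facts). The main result,
`Literature.NumberTheory.GaloisRepresentations.NumberField.exists_prime_gt_padicEmbedding`, is the glue used in the assembly of
Deligne–Serre's Thm. 4.1 (op. cit. §8.6: comparison of an `ℓ`-adic lift of a mod-`ℓ` Galois
representation with complex data):

* for a number field `K` with a complex embedding `φ : K → ℂ` and any bound `B`, there is a
  prime `ℓ > B`, a ring homomorphism `e : 𝓞 K → ℤ_ℓ` and a ring homomorphism `c : ℚ_ℓ → ℂ`
  with `c ∘ e = φ` on `𝓞 K`.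

Proof: let `θ` be an integral primitive element of `K/ℚ` with minimal polynomial `f ∈ ℤ[X]`.
For all but finitely many `ℓ` the reduction `f mod ℓ` is separable (Bezout identity over `ℚ`,
denominators cleared), and by the tree's "poor man's Chebotarev theorem"
`Literature.NumberTheory.Sieve.exists_prime_gt_map_int_splits` there are arbitrarily large `ℓ` for which `f mod ℓ`
splits into linear factors; by Hensel's lemma (Mathlib `hensels_lemma`) `f` then has `deg f`
roots in `ℤ_ℓ`, hence all the roots of `f` in any extension of `ℚ_ℓ` lie in `ℤ_ℓ`. Now
`\bar ℚ_ℓ ≃ ℂ` as abstract fields (algebraically closed of characteristic `0` and cardinality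
`𝔠`, Mathlib `IsAlgClosed.ringEquiv_of_equiv_of_charZero`); transporting `φ` along such an
isomorphism `ψ` gives an embedding `K → \bar ℚ_ℓ` whose image `ℚ(ψ⁻¹ φ θ)` lies in `ℚ_ℓ`, and
its restriction to `𝓞 K` lands in the integrally closed subring `ℤ_ℓ`; `c` is `ψ` restricted to
`ℚ_ℓ`.

## Main statements

* `Literature.NumberTheory.GaloisRepresentations.NumberField.cardinalMk_padic` — `#ℚ_ℓ = 𝔠`.
* `Literature.NumberTheory.GaloisRepresentations.NumberField.nonempty_algebraicClosure_padic_ringEquiv_complex` — `\bar ℚ_ℓ ≃+* ℂ`.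
* `Literature.NumberTheory.GaloisRepresentations.NumberField.exists_forall_separable_map` — an integer polynomial separable over `ℚ` is
  separable modulo all primes not dividing some `D ≠ 0`.
* `Literature.NumberTheory.GaloisRepresentations.NumberField.exists_aeval_eq_zero_and_toZMod_eq` — Hensel: simple roots mod `ℓ` lift.
* `Literature.NumberTheory.GaloisRepresentations.NumberField.exists_coe_eq_of_aeval_eq_zero` — if `f mod ℓ` is separable and split, every
  root of the monic `f` in an extension of `ℚ_ℓ` lies in `ℤ_ℓ`.
* `Literature.NumberTheory.GaloisRepresentations.NumberField.exists_prime_gt_padicEmbedding` — the main result.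

## References

* P. Deligne, J.-P. Serre, *Formes modulaires de poids 1*, Ann. Sci. ÉNS (4) 7 (1974), §8.2,
  §8.6 (the use made of such primes `ℓ`).
* J. Neukirch, *Algebraic Number Theory*, Ch. II, (4.6) (Hensel's lemma), (8.2).
-/

noncomputable section

open Polynomial
open scoped Cardinal NumberField IntermediateField

namespace Literature.NumberTheory.GaloisRepresentations.NumberField

/-! ### Cardinalities and the abstract isomorphism `\bar ℚ_ℓ ≃ ℂ` -/

section Cardinal

variable (p : ℕ) [Fact p.Prime]

/-- `#ℚ_p = 𝔠`: at most `𝔠` as a quotient of a set of sequences of rationals, at least `𝔠` as a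
complete nontrivially normed field. [folklore] -/
theorem cardinalMk_padic : #ℚ_[p] = 𝔠 := by
  apply le_antisymm
  · have hsurj : Function.Surjective (Padic.mk : PadicSeq p → ℚ_[p]) :=
      fun x ↦ Quotient.inductionOn' x fun a ↦ ⟨a, rfl⟩
    calc #ℚ_[p] ≤ #(PadicSeq p) := Cardinal.mk_le_of_surjective hsurj
      _ ≤ #(ℕ → ℚ) := Cardinal.mk_subtype_le _
      _ = 𝔠 := by
        rw [Cardinal.mk_arrow, Cardinal.mk_eq_aleph0 ℚ, Cardinal.mk_eq_aleph0 ℕ]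
        simp [Cardinal.aleph0_power_aleph0]
  · exact continuum_le_cardinal_of_nontriviallyNormedField ℚ_[p]

/-- `#\bar ℚ_p = 𝔠`. [folklore] -/
theorem cardinalMk_algebraicClosure_padic : #(AlgebraicClosure ℚ_[p]) = 𝔠 := by
  apply le_antisymm
  · refine (Algebra.IsAlgebraic.cardinalMk_le_max ℚ_[p] (AlgebraicClosure ℚ_[p])).trans ?_
    rw [cardinalMk_padic, max_eq_left Cardinal.aleph0_le_continuum]
  · rw [← cardinalMk_padic p]
    exact Cardinal.mk_le_of_injective (algebraMap ℚ_[p] (AlgebraicClosure ℚ_[p])).injective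

/-- An algebraic closure of `ℚ_p` is isomorphic, as an abstract field, to `ℂ` (both are
algebraically closed of characteristic zero and cardinality `𝔠`). [folklore] -/
theorem nonempty_algebraicClosure_padic_ringEquiv_complex :
    Nonempty (AlgebraicClosure ℚ_[p] ≃+* ℂ) := by
  refine IsAlgClosed.ringEquiv_of_equiv_of_charZero ?_ (Cardinal.eq.1 ?_)
  · rw [cardinalMk_algebraicClosure_padic]
    exact Cardinal.aleph0_lt_continuum
  · rw [cardinalMk_algebraicClosure_padic, Cardinal.mk_complex]

end Cardinal

/-! ### Separability modulo almost all primes -/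

/-- An integer polynomial which is separable over `ℚ` is separable modulo every prime `ℓ` not
dividing some non-zero integer `D` (clear denominators in a Bezout identity
`u f + v f' = 1` over `ℚ`). [folklore] -/
theorem exists_forall_separable_map (f : ℤ[X]) (hf : (f.map (algebraMap ℤ ℚ)).Separable) :
    ∃ D : ℤ, D ≠ 0 ∧ ∀ (ℓ : ℕ) [Fact ℓ.Prime], ¬ (ℓ : ℤ) ∣ D →
      (f.map (Int.castRingHom (ZMod ℓ))).Separable := by
  obtain ⟨u, v, huv⟩ := hf
  obtain ⟨bu, hbuM, hU⟩ := IsLocalization.integerNormalization_spec (nonZeroDivisors ℤ) u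
  obtain ⟨bv, hbvM, hV⟩ := IsLocalization.integerNormalization_spec (nonZeroDivisors ℤ) v
  set U : ℤ[X] := IsLocalization.integerNormalization (nonZeroDivisors ℤ) u
  set V : ℤ[X] := IsLocalization.integerNormalization (nonZeroDivisors ℤ) v
  have hbu : bu ≠ 0 := nonZeroDivisors.ne_zero hbuM
  have hbv : bv ≠ 0 := nonZeroDivisors.ne_zero hbvM
  -- the integral Bezout identity `bv U f + bu V f' = bu bv`
  have huv' : u * f.map (algebraMap ℤ ℚ) + v * (derivative f).map (algebraMap ℤ ℚ) = 1 := by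
    rwa [← Polynomial.derivative_map]
  have hid : C bv * U * f + C bu * V * derivative f = C (bu * bv) := by
    apply Polynomial.map_injective (algebraMap ℤ ℚ) (algebraMap ℤ ℚ).injective_int
    simp only [Polynomial.map_add, Polynomial.map_mul, hU, hV, zsmul_eq_mul, eq_intCast,
      Int.cast_mul, Polynomial.map_intCast]
    linear_combination ((bu : ℚ[X]) * (bv : ℚ[X])) * huv'
  refine ⟨bu * bv, mul_ne_zero hbu hbv, fun ℓ _ hℓ ↦ ?_⟩
  have hD : ((bu * bv : ℤ) : ZMod ℓ) ≠ 0 := by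
    rwa [Ne, ZMod.intCast_zmod_eq_zero_iff_dvd]
  have hidℓ := congrArg (Polynomial.map (Int.castRingHom (ZMod ℓ))) hid
  simp only [Polynomial.map_add, Polynomial.map_mul, Polynomial.map_C,
    ← Polynomial.derivative_map, Int.coe_castRingHom] at hidℓ
  set fl := f.map (Int.castRingHom (ZMod ℓ))
  rw [Polynomial.separable_def]
  have h1 : C (((bu * bv : ℤ) : ZMod ℓ)⁻¹) * C ((bu * bv : ℤ) : ZMod ℓ) = 1 := by
    rw [← C_mul, inv_mul_cancel₀ hD, C_1]
  refine ⟨C (((bu * bv : ℤ) : ZMod ℓ)⁻¹) * C ((bv : ℤ) : ZMod ℓ) *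
      U.map (Int.castRingHom (ZMod ℓ)),
    C (((bu * bv : ℤ) : ZMod ℓ)⁻¹) * C ((bu : ℤ) : ZMod ℓ) * V.map (Int.castRingHom (ZMod ℓ)), ?_⟩
  linear_combination (C (((bu * bv : ℤ) : ZMod ℓ)⁻¹)) * hidℓ + h1

/-! ### Hensel: lifting simple roots to `ℤ_ℓ` -/

section Hensel

variable {ℓ : ℕ} [Fact ℓ.Prime]

/-- Reduction modulo `ℓ` commutes with evaluation of integer polynomials. [folklore] -/
lemma toZMod_aeval (g : ℤ[X]) (a : ℤ_[ℓ]) :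
    PadicInt.toZMod (aeval a g) = (g.map (Int.castRingHom (ZMod ℓ))).eval (PadicInt.toZMod a) := by
  rw [Polynomial.aeval_def, Polynomial.hom_eval₂, Polynomial.eval_map]
  congr 1
  exact RingHom.ext_int _ _

/-- **Hensel's lemma for simple roots.** If `f mod ℓ` is separable, every root of `f mod ℓ` in
`𝔽_ℓ` lifts to a root of `f` in `ℤ_ℓ` (Mathlib `hensels_lemma`). [folklore] -/
theorem exists_aeval_eq_zero_and_toZMod_eq (f : ℤ[X])
    (hsep : (f.map (Int.castRingHom (ZMod ℓ))).Separable) (r : ZMod ℓ)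
    (hr : (f.map (Int.castRingHom (ZMod ℓ))).IsRoot r) :
    ∃ z : ℤ_[ℓ], aeval z f = 0 ∧ PadicInt.toZMod z = r := by
  set a : ℤ_[ℓ] := (r.val : ℤ_[ℓ]) with ha
  have har : PadicInt.toZMod a = r := by
    rw [ha, map_natCast, ZMod.natCast_zmod_val]
  -- `f(a) ≡ 0 (mod ℓ)`
  have h1 : ‖aeval a f‖ < 1 := by
    have hmem : aeval a f ∈ RingHom.ker (PadicInt.toZMod (p := ℓ)) := by
      rw [RingHom.mem_ker, toZMod_aeval, har]
      exact hr
    rw [PadicInt.ker_toZMod] at hmem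
    exact PadicInt.mem_nonunits.mp hmem
  -- `f'(a)` is a unit
  have h2 : ‖aeval a (derivative f)‖ = 1 := by
    rw [← PadicInt.isUnit_iff]
    by_contra hunit
    have hmem : aeval a (derivative f) ∈ IsLocalRing.maximalIdeal ℤ_[ℓ] :=
      (IsLocalRing.mem_maximalIdeal _).mpr (mem_nonunits_iff.mpr hunit)
    rw [← PadicInt.ker_toZMod, RingHom.mem_ker, toZMod_aeval, har,
      ← Polynomial.derivative_map] at hmem
    exact (hsep.eval₂_derivative_ne_zero (RingHom.id _) (x := r)
      (by rw [eval₂_id]; exact hr)) (by rw [eval₂_id]; exact hmem)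
  have hnorm : ‖aeval a f‖ < ‖aeval a (derivative f)‖ ^ 2 := by
    rw [h2, one_pow]; exact h1
  obtain ⟨z, hz, hza, -, -⟩ := hensels_lemma hnorm
  refine ⟨z, hz, ?_⟩
  rw [h2] at hza
  have hmem : z - a ∈ IsLocalRing.maximalIdeal ℤ_[ℓ] :=
    (IsLocalRing.mem_maximalIdeal _).mpr (PadicInt.mem_nonunits.mpr hza)
  rw [← PadicInt.ker_toZMod, RingHom.mem_ker, map_sub, sub_eq_zero] at hmem
  rw [hmem, har]

/-- If `f ∈ ℤ[X]` is monic and `f mod ℓ` is separable and splits into linear factors over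
`𝔽_ℓ`, then `f` has `deg f` distinct roots in `ℤ_ℓ`, and consequently every root of `f` in any
field extension `L` of `ℚ_ℓ` is (the image of) an element of `ℤ_ℓ`. [folklore] -/
theorem exists_coe_eq_of_aeval_eq_zero (f : ℤ[X]) (hmonic : f.Monic)
    (hsep : (f.map (Int.castRingHom (ZMod ℓ))).Separable)
    (hsplit : (f.map (Int.castRingHom (ZMod ℓ))).Splits)
    {L : Type*} [Field L] [Algebra ℚ_[ℓ] L] (β : L) (hβ : aeval β f = 0) :
    ∃ z : ℤ_[ℓ], algebraMap ℚ_[ℓ] L (z : ℚ_[ℓ]) = β := by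
  classical
  set fl := f.map (Int.castRingHom (ZMod ℓ)) with hfl
  have hfl0 : fl ≠ 0 := (hmonic.map _).ne_zero
  -- the distinct roots of `f mod ℓ` and their Hensel lifts
  set S : Finset (ZMod ℓ) := fl.roots.toFinset with hS
  have hScard : S.card = f.natDegree := by
    rw [hS, Multiset.toFinset_card_of_nodup (nodup_roots hsep), splits_iff_card_roots.mp hsplit,
      hmonic.natDegree_map]
  have hroot : ∀ r ∈ S, fl.IsRoot r := fun r hr ↦
    (mem_roots hfl0).mp (Multiset.mem_toFinset.mp hr)
  choose z hz hzr using fun r (hr : r ∈ S) ↦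
    exists_aeval_eq_zero_and_toZMod_eq f hsep r (hroot r hr)
  -- the embedding `ℤ_ℓ → L`
  let ι : ℤ_[ℓ] →+* L := (algebraMap ℚ_[ℓ] L).comp PadicInt.Coe.ringHom
  have hι : Function.Injective ι :=
    (algebraMap ℚ_[ℓ] L).injective.comp (fun a b h ↦ PadicInt.ext h)
  have hιroot : ∀ x : ℤ_[ℓ], aeval x f = 0 → aeval (ι x) f = 0 := fun x hx ↦ by
    have h : aeval (ι x) f = ι (aeval x f) := Polynomial.aeval_algHom_apply ι.toIntAlgHom x f
    rw [h, hx, map_zero]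
  -- the `deg f` distinct roots `ι (z r)` of `f` in `L`
  set T : Finset L := S.attach.image fun r ↦ ι (z r.1 r.2) with hT
  have hTcard : T.card = f.natDegree := by
    rw [hT, Finset.card_image_of_injective _ (fun r r' h ↦ ?_), Finset.card_attach, hScard]
    apply Subtype.ext
    rw [← hzr r.1 r.2, ← hzr r'.1 r'.2, hι h]
  set fL := f.map (algebraMap ℤ L) with hfL
  have hfL0 : fL ≠ 0 := (hmonic.map _).ne_zero
  have hfLdeg : fL.natDegree = f.natDegree := hmonic.natDegree_map _
  have hTroots : ∀ x ∈ T, x ∈ fL.roots := by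
    intro x hx
    obtain ⟨r, -, rfl⟩ := Finset.mem_image.mp hx
    rw [mem_roots hfL0, IsRoot.def, eval_map, ← aeval_def]
    exact hιroot _ (hz r.1 r.2)
  -- `β` is one of them, by counting roots
  by_contra hcon
  have hβT : β ∉ T := fun h ↦ by
    obtain ⟨r, -, hr⟩ := Finset.mem_image.mp h
    exact hcon ⟨z r.1 r.2, hr⟩
  have hβroot : β ∈ fL.roots := by
    rw [mem_roots hfL0, IsRoot.def, eval_map, ← aeval_def]
    exact hβ
  have hsub : (insert β T).val ⊆ fL.roots := by
    intro x hx
    rcases Finset.mem_insert.mp (Finset.mem_val.mp hx) with rfl | hx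
    · exact hβroot
    · exact hTroots x hx
  have hle : (insert β T).val ≤ fL.roots := Finset.val_le_iff_val_subset.mpr hsub
  have h1 := Multiset.card_le_card hle
  rw [Finset.card_val, Finset.card_insert_of_notMem hβT, hTcard] at h1
  have h2 := Polynomial.card_roots' fL
  rw [hfLdeg] at h2
  omega

end Hensel

/-! ### The main result -/

/-- **Compatible `ℓ`-adic and complex embeddings.** Let `K` be a number field with a complex
embedding `φ : K → ℂ`. For every bound `B` there is a prime `ℓ > B`, a ring homomorphism
`e : 𝓞 K → ℤ_ℓ` and a ring homomorphism `c : ℚ_ℓ → ℂ` such that `c (e x) = φ x` for all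
`x ∈ 𝓞 K`. (Take `ℓ` split by an integral primitive element, Hensel's lemma, and an abstract
field isomorphism `\bar ℚ_ℓ ≃ ℂ`; see the module docstring.) [folklore] -/
theorem exists_prime_gt_padicEmbedding (K : Type*) [Field K] [NumberField K] (φ : K →+* ℂ)
    (B : ℕ) :
    ∃ (ℓ : ℕ) (hℓ : ℓ.Prime), B < ℓ ∧
      (haveI : Fact ℓ.Prime := ⟨hℓ⟩; ∃ (e : 𝓞 K →+* ℤ_[ℓ]) (c : ℚ_[ℓ] →+* ℂ),
         ∀ x : 𝓞 K, c (e x : ℚ_[ℓ]) = φ (algebraMap (𝓞 K) K x)) := by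
  classical
  -- an integral primitive element `θ` with minimal polynomial `f ∈ ℤ[X]`
  obtain ⟨α, hα⟩ := Field.exists_primitive_element ℚ K
  obtain ⟨y, hy0, hθint⟩ :=
    ((IsFractionRing.isAlgebraic_iff ℤ ℚ K).mpr (Algebra.IsAlgebraic.isAlgebraic (R := ℚ) α)
      ).exists_integral_multiple
  set θ : K := y • α with hθdef
  have hθtop : ℚ⟮θ⟯ = ⊤ := by
    rw [eq_top_iff, ← hα, IntermediateField.adjoin_simple_le_iff]
    have hy : (y : K) ≠ 0 := by exact_mod_cast hy0
    have : α = (y : K)⁻¹ * θ := by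
      rw [hθdef, zsmul_eq_mul, ← mul_assoc, inv_mul_cancel₀ hy, one_mul]
    rw [this]
    exact mul_mem (inv_mem (intCast_mem _ y)) (IntermediateField.mem_adjoin_simple_self ℚ θ)
  set f : ℤ[X] := minpoly ℤ θ with hf
  have hfmonic : f.Monic := minpoly.monic hθint
  have hfQ : f.map (algebraMap ℤ ℚ) = minpoly ℚ θ :=
    (minpoly.isIntegrallyClosed_eq_field_fractions' ℚ hθint).symm
  have hsepQ : (f.map (algebraMap ℤ ℚ)).Separable := by
    rw [hfQ]
    exact Algebra.IsSeparable.isSeparable ℚ θ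
  obtain ⟨D, hD0, hD⟩ := exists_forall_separable_map f hsepQ
  -- a large prime `ℓ` modulo which `f` is separable and split
  obtain ⟨ℓ, hℓ, hℓgt, hsplit⟩ :=
    Literature.NumberTheory.Sieve.exists_prime_gt_map_int_splits f hfmonic.ne_zero (max B D.natAbs)
  refine ⟨ℓ, hℓ, lt_of_le_of_lt (le_max_left _ _) hℓgt, ?_⟩
  haveI := Fact.mk hℓ
  have hℓD : ¬ (ℓ : ℤ) ∣ D := fun h ↦ by
    have h1 : ℓ ≤ D.natAbs := Nat.le_of_dvd (Int.natAbs_pos.mpr hD0) (Int.natCast_dvd.mp h)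
    have h2 : D.natAbs < ℓ := lt_of_le_of_lt (le_max_right B _) hℓgt
    omega
  have hsep := hD ℓ hℓD
  -- an abstract isomorphism `ψ : \bar ℚ_ℓ ≃ ℂ`; `β = ψ⁻¹ (φ θ)` is a root of `f`, hence `ℓ`-adic
  obtain ⟨ψ⟩ := nonempty_algebraicClosure_padic_ringEquiv_complex ℓ
  set L := AlgebraicClosure ℚ_[ℓ]
  let g : K →+* L := ψ.symm.toRingHom.comp φ
  have hgθ : aeval (g θ) f = 0 := by
    have h : aeval (g θ) f = g (aeval θ f) := Polynomial.aeval_algHom_apply g.toIntAlgHom θ f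
    rw [h, hf, minpoly.aeval, map_zero]
  obtain ⟨z₀, hz₀⟩ := exists_coe_eq_of_aeval_eq_zero f hfmonic hsep hsplit (g θ) hgθ
  -- the image of `g` lies in `ℚ_ℓ`
  set ιL : ℚ_[ℓ] →+* L := algebraMap ℚ_[ℓ] L
  have hrange : ∀ x : K, g x ∈ ιL.range := by
    intro x
    obtain ⟨b, hb0, r, hr⟩ := Literature.NumberTheory.Sieve.exists_int_mul_eq_aeval hθtop x
    have hgr : g (aeval θ r) = ιL (aeval (z₀ : ℚ_[ℓ]) r) := by
      have h1 : aeval (g θ) r = g (aeval θ r) := Polynomial.aeval_algHom_apply g.toIntAlgHom θ r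
      have h2 : aeval (ιL (z₀ : ℚ_[ℓ])) r = ιL (aeval (z₀ : ℚ_[ℓ]) r) :=
        Polynomial.aeval_algHom_apply ιL.toIntAlgHom (z₀ : ℚ_[ℓ]) r
      rw [← h1, ← hz₀, h2]
    have hb : (b : L) ≠ 0 := by exact_mod_cast hb0
    have hx : g x = ιL (aeval (z₀ : ℚ_[ℓ]) r / b) := by
      have := congrArg g hr
      rw [map_mul, map_intCast, hgr] at this
      rw [map_div₀, map_intCast, eq_div_iff hb, mul_comm, this]
    exact ⟨_, hx.symm⟩
  -- `e' : K → ℚ_ℓ` with `ιL ∘ e' = g`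
  have hιinj : Function.Injective ιL := ιL.injective
  let eqv : ℚ_[ℓ] ≃+* ιL.range := RingEquiv.ofBijective ιL.rangeRestrict
    ⟨fun a b h ↦ hιinj (congrArg Subtype.val h), RingHom.rangeRestrict_surjective ιL⟩
  let e' : K →+* ℚ_[ℓ] := eqv.symm.toRingHom.comp (g.codRestrict ιL.range hrange)
  have he' : ∀ x : K, ιL (e' x) = g x := by
    intro x
    change ((ιL.rangeRestrict (eqv.symm (g.codRestrict ιL.range hrange x))) : L) = g x
    have : ιL.rangeRestrict (eqv.symm (g.codRestrict ιL.range hrange x)) =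
        eqv (eqv.symm (g.codRestrict ιL.range hrange x)) := rfl
    rw [this, RingEquiv.apply_symm_apply]
    rfl
  -- `c = ψ|_{ℚ_ℓ}`
  let c : ℚ_[ℓ] →+* ℂ := ψ.toRingHom.comp ιL
  have hce' : ∀ x : K, c (e' x) = φ x := by
    intro x
    change ψ (ιL (e' x)) = φ x
    rw [he' x]
    exact ψ.apply_symm_apply (φ x)
  -- integrality: `e'` maps `𝓞 K` into `ℤ_ℓ`
  have hint : ∀ x : 𝓞 K, ‖e' (algebraMap (𝓞 K) K x)‖ ≤ 1 := by
    intro x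
    have h1 : IsIntegral ℤ (e' (algebraMap (𝓞 K) K x)) :=
      (NumberField.RingOfIntegers.isIntegral_coe x).map e'.toIntAlgHom
    have h2 : IsIntegral ℤ_[ℓ] (e' (algebraMap (𝓞 K) K x)) := h1.tower_top
    obtain ⟨w, hw⟩ := (IsIntegrallyClosed.isIntegral_iff (R := ℤ_[ℓ]) (K := ℚ_[ℓ])).mp h2
    rw [← hw]
    exact w.2
  let e : 𝓞 K →+* ℤ_[ℓ] :=
    { toFun := fun x ↦ ⟨e' (algebraMap (𝓞 K) K x), hint x⟩
      map_one' := PadicInt.ext (by simp)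
      map_mul' := fun a b ↦ PadicInt.ext (by simp)
      map_zero' := PadicInt.ext (by simp)
      map_add' := fun a b ↦ PadicInt.ext (by simp) }
  exact ⟨e, c, fun x ↦ hce' _⟩

end Literature.NumberTheory.GaloisRepresentations.NumberField
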